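import Literature.NumberTheory.EllipticCurves.Agboola2007.RestrictedSelmerGroups
import Literature.NumberTheory.EllipticCurves.KellerYin2024.CharacterSelmerGroups
import Literature.NumberTheory.EllipticCurves.Castella2018.AnticyclotomicSelmerDual
import HarnessLib

/-!
# Agboola 2007, §1 p. 2 and §3: the Iwasawa module `X_𝔮(K_∞, M) = 𝔖_𝔮(K_∞, M)^∧` — the `Λ`-DUAL of the
# restricted Selmer group over a `ℤ_p`-extension, its characteristic ideal and the shape «`H(0) ≠ 0`,
# `ord_p H(0) = n`» — DEFINITIONS ONLY, assembled from the tree's generic constructors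

Topic `Literature/NumberTheory/EllipticCurves/Agboola2007` (companion of `RestrictedSelmerGroups.lean`, ty2 g25
p645913). Cell `bsd-print-cf2`, LEAD seat `bsd-line-cf2-p1` g10 (crux stmt-BirchSwinnertonDyer-20368, road α: the
carrier the planner's RULING (ab)(5) split S3b = S3b′ ∘ S3c is typed on). No named fact, no instance beyond the
structure-field instances of the dual datum (verbatim the pattern of `KellerYin2024.GrDualData` /
`GreenbergVatsal2000.DatumDualData`), no `sorry`; nothing is asserted about finite generation, torsion, control or
any main conjecture.

## Source, verbatim (held text `paper:arxiv-math_0602192`)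

Agboola, *On Rubin's variant of the p-adic Birch and Swinnerton-Dyer conjecture*, Compositio Math. 143 (2007)
(arXiv:math/0602192), §1 p. 2 (p0004 L1–L13): "The Iwasawa module in question is the Pontryagin dual
`X_{𝔭*}(K_∞^*, W^*)` of a certain restricted Selmer group `𝔖_{𝔭*}(K_∞^*, W^*)`. This restricted Selmer group is
defined by reversing the Selmer conditions above `𝔭` and `𝔭*` that are used to define the usual Selmer group
`Sel(K_∞^*, W^*)`. The two-variable main conjecture implies that a characteristic power series
`H_K ∈ Λ(K_∞^*)` of `X_{𝔭*}(K_∞^*, W^*)` may be viewed as being an algebraic `p`-adic `L`-function corresponding to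
`L_𝔭^*(s)`."; §1 p. 1 (p0003 L14–L16): "`Λ(L) := Λ(Gal(L/K)) := ℤ_p[[Gal(L/K)]]`"; §3 (p0008 L94–L95): "For any
extension `L/K`, we set `Sel_?(L,M)^∧ = X_?(L,M)`, `𝔖_𝔮(L,M)^∧ = X_𝔮(L,M)`" (Notation, p0005: "`^∧`" = Pontryagin
dual); Thm. 2 (p0004 L93–L101, `r ≥ 1`): "`lim_{s→1} L_𝔭^*(s)/(s−1)^{r−1} ∼ [log_p(ψ*(γ))]^{r−1} · p^{−2} ·
|Ш(K)(𝔭*)| · log_{E,𝔭*}(y_{𝔭*}) · log_{E,𝔭}(y_𝔭) · 𝓡_{K,𝔭*}`" — the number `H_K(0)` up to a unit when `r = 1`.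

## Content

For `K` a number field, `κ : ZpExtension K p` with topological generator `γ`, a discrete `Γ_K`-module `M` and a
finite place `𝔮` (intended: `𝔮 ∣ p` split, `κ` unramified outside `𝔮`, `M = E[𝔮^∞]`):
* `conjRestricted κ M 𝔮 γ` — `conj_γ` as an endomorphism of `𝔖_𝔮(K_∞, M) = Agboola2007.restrictedSelmerZp κ M 𝔮`
  (stable: `conjH1_mem_restrictedSelmerZp`); `isLocNil_conjRestricted_sub_one`: for `M` `p`-primary with open
  stabilisers, `γ − 1` is locally nilpotent on the `p`-primary group `𝔖_𝔮(K_∞, M)` (Greenberg LNM 1716 §1; the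
  tree's tower lemmas `exists_pow_smul_subgroupH1_eq_zero`, `exists_conjH1_pow_prime_pow_eq`).
* `RestrictedDualData κ M 𝔮 γ` — Pontryagin-dual data `X_𝔮(K_∞, M) = Hom(𝔖_𝔮(K_∞, M), ℚ/ℤ)` with its
  `Λ(K_∞) = ℤ_p⟦T⟧ = IwasawaAlgebra p`-structure, `1 + T ↦ γ` (module structure as DATA, two axioms; VERBATIM the
  shape of `GreenbergVatsal2000.DatumDualData` / `KellerYin2024.GrDualData` with the Selmer group replaced by
  `restrictedSelmerZp`); `restrictedDualData` — such data EXIST for `M` `p`-primary with open stabilisers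
  (`toDual = id`, module structure `IwasawaDual.IsLocNil.module`).
* `RestrictedDualData.charIdeal D = Ch_Λ(X_𝔮(K_∞, M))` (the tree's `Module.charIdeal`; a generator is Agboola's
  "characteristic power series `H`"); `RestrictedDualData.HasCharValuationAt D n` — the SHAPE «`X_𝔮` is
  `Λ`-torsion, `Ch_Λ = (H)`, `H(0) ≠ 0`, `ord_p H(0) = n`» (the left-hand side of Thm. 2 at `r = 1`), with
  `HasCharValuationAt.unique` (generator independence, `Castella2018.AcSelmer.valuation_constantCoeff_eq_of_span_singleton_eq`).
TODO(general form): `Λ(L)_𝒪 = 𝒪[[Gal(L/K)]]`-coefficients (Agboola's `e_F^{−1}H_F`, §3 Thm. 3.3) and the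
compact groups `𝔖̌_𝔮(F, T)`; not needed by the consumer (road α reads `ord_2 H(0)` only).

References: [Agboola2007] §1 pp. 1–2, §3 (Def. of `𝔖_𝔮`, `X_𝔮`), Thm. 2; [GreenbergVatsal2000] §2 p. 17 (the
`Λ`-module structure on duals of Selmer groups over `ℤ_p`-extensions); [GreenbergLNM1716] §1 (after Conj. 1.3);
[Castella2018] §2.2 (`1 + T ↦ γ`), Thm. 2.3 (`#ℤ_p/f(0)`).
-/

noncomputable section

open scoped Classical

open NumberField IsDedekindDomain Field
open Literature.NumberTheory.EllipticCurves Literature.NumberTheory.EllipticCurves.GreenbergSelmer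
open Literature.NumberTheory.EllipticCurves.GreenbergVatsal2000
open Literature.NumberTheory.GaloisRepresentations

universe u

namespace Literature.NumberTheory.EllipticCurves.Agboola2007

section Generic

variable {K : Type u} [Field K] [NumberField K] {p : ℕ} [Fact p.Prime] (κ : ZpExtension K p)
  (M : Type u) [AddCommGroup M] [DistribMulAction (absoluteGaloisGroup K) M] [TopologicalSpace M]
  [DiscreteTopology M] (𝔮 : HeightOneSpectrum (𝓞 K))

/-! ## §1 The `Γ = Gal(K_∞/K)`-action on `𝔖_𝔮(K_∞, M)` and local nilpotence of `γ − 1` -/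

/-- `conj_γ` (`γ ∈ Γ_K`) as an endomorphism of the restricted Selmer group `𝔖_𝔮(K_∞, M)` — the action of
`Gal(K_∞/K)` through which `Λ(K_∞) = ℤ_p[[Gal(K_∞/K)]]` acts on the dual ("`Λ(L) := ℤ_p[[Gal(L/K)]]`", §1 p. 1;
stability `conjH1_mem_restrictedSelmerZp`). [cite: Agboola2007, §1 p. 1 (arXiv p0003:L14–16) and §3 (p0008:L76–80)]
[cite: GreenbergVatsal2000, §2 p. 17] -/
def conjRestricted (γ : absoluteGaloisGroup K) : AddMonoid.End (restrictedSelmerZp κ M 𝔮) :=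
  ((conjH1 κ.kerSubgroup M γ).restrict (restrictedSelmerZp κ M 𝔮)).codRestrict (restrictedSelmerZp κ M 𝔮)
    fun s ↦ conjH1_mem_restrictedSelmerZp κ M 𝔮 γ s.2

/-- Unfolding `conjRestricted`: on classes it is `conj_γ` (definitional).
[cite: Agboola2007, §3 (arXiv p0008:L76–80)] -/
@[simp]
theorem coe_conjRestricted_apply (γ : absoluteGaloisGroup K) (s : restrictedSelmerZp κ M 𝔮) :
    ((conjRestricted κ M 𝔮 γ s : restrictedSelmerZp κ M 𝔮) : subgroupH1 κ.kerSubgroup M) =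
      conjH1 κ.kerSubgroup M γ s :=
  rfl

/-- Powers: `(conjRestricted γ)^m = conj_{γ^m}` (`conjH1_one`, `conjH1_mul`). [folklore] -/
private theorem coe_conjRestricted_pow_apply (γ : absoluteGaloisGroup K) (m : ℕ)
    (s : restrictedSelmerZp κ M 𝔮) :
    ((((conjRestricted κ M 𝔮 γ) ^ m) s : restrictedSelmerZp κ M 𝔮) : subgroupH1 κ.kerSubgroup M) =
      conjH1 κ.kerSubgroup M (γ ^ m) s := by
  induction m generalizing s with
  | zero => rw [pow_zero, pow_zero, AddMonoid.End.one_apply,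
      Literature.NumberTheory.EllipticCurves.conjH1_one_holds κ.kerSubgroup M, AddMonoidHom.id_apply]
  | succ m ih =>
    rw [pow_succ, AddMonoid.End.coe_mul, Function.comp_apply, ih, coe_conjRestricted_apply, pow_succ,
      Literature.NumberTheory.EllipticCurves.conjH1_mul_holds κ.kerSubgroup M, AddMonoidHom.comp_apply]

variable {M}

/-- **`T = γ − 1` is locally nilpotent on `𝔖_𝔮(K_∞, M)` and the group is `p`-primary**, for `M` `p`-primary
with open stabilisers and `γ` a topological generator of `Gal(K_∞/K)`: every class is killed by a power of `p`
and by a power of `γ − 1` (Greenberg, LNM 1716 §1: "a torsion `ℤ_p`-module, every element of which is killed by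
`Tⁿ`"), via the tree's generic tower lemmas — the restricted twin of `KellerYin2024.isLocNil_conjGr_sub_one`.
[cite: GreenbergLNM1716, §1 (after Conj. 1.3)] [cite: Agboola2007, §3 (arXiv p0008:L76–95)] -/
theorem isLocNil_conjRestricted_sub_one (htor : ∀ m : M, ∃ k : ℕ, p ^ k • m = 0)
    (hstab : ∀ m : M, IsOpen (MulAction.stabilizer (absoluteGaloisGroup K) m : Set (absoluteGaloisGroup K)))
    {γ : absoluteGaloisGroup K} (hγ : κ.IsTopGenerator γ) :
    IwasawaDual.IsLocNil p (conjRestricted κ M 𝔮 γ - 1) := by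
  have htor' : ∀ s : restrictedSelmerZp κ M 𝔮, ∃ k : ℕ, p ^ k • s = 0 := fun s ↦ by
    obtain ⟨k, hk⟩ := GreenbergSelmer.exists_pow_smul_subgroupH1_eq_zero κ M htor
      (s : subgroupH1 κ.kerSubgroup M)
    exact ⟨k, Subtype.ext (by rw [AddSubgroupClass.coe_nsmul]; exact hk)⟩
  refine ⟨htor', fun s ↦ ?_⟩
  obtain ⟨a, ha⟩ := GreenbergSelmer.exists_conjH1_pow_prime_pow_eq κ M hstab hγ
    (s : subgroupH1 κ.kerSubgroup M)
  obtain ⟨k, hk⟩ := htor' s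
  have hφ : ((conjRestricted κ M 𝔮 γ) ^ p ^ a) s = s :=
    Subtype.ext (by rw [coe_conjRestricted_pow_apply]; exact ha)
  exact ⟨k * p ^ a, IwasawaDual.pow_mul_prime_pow_apply_eq_zero (Fact.out : p.Prime) _ a hφ hk⟩

variable (M)

/-! ## §2 Pontryagin-dual data `X_𝔮(K_∞, M) = 𝔖_𝔮(K_∞, M)^∧` with its `Λ(K_∞)`-structure -/

/-- **Pontryagin-dual data `X_𝔮(K_∞, M) = 𝔖_𝔮(K_∞, M)^∧` with its `Λ(K_∞) = ℤ_p⟦T⟧`-structure,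
`1 + T ↦ γ`** ("`𝔖_𝔮(L,M)^∧ = X_𝔮(L,M)`", §3; "`Λ(L) := ℤ_p[[Gal(L/K)]]`", §1): a `Λ = IwasawaAlgebra p`-module `X`
with a group isomorphism `toDual : X ≅ Hom(𝔖_𝔮(K_∞, M), ℚ/ℤ)` under which `T` acts as `γ − 1` (through
`conjRestricted`) and constants `c ∈ ℤ_p` act on `p^k`-torsion classes through `ℤ_p → ℤ/p^k` — VERBATIM the
tree's `GreenbergVatsal2000.DatumDualData` / `KellerYin2024.GrDualData` with the Selmer group replaced by
`Agboola2007.restrictedSelmerZp κ M 𝔮`. Module structure as DATA; existence for `p`-primary `M` with open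
stabilisers is `restrictedDualData`. Agboola's `X_{𝔭*}(K*_∞, W*)` is the case `κ` unramified outside `𝔮 = 𝔭*`,
`M = W* = E[𝔭*^∞]`. [cite: Agboola2007, §1 p. 2 (arXiv p0004:L3–13) and §3 (p0008:L94–95)] [cite: GreenbergVatsal2000, §2 p. 17] -/
structure RestrictedDualData (γ : absoluteGaloisGroup K) where
  /-- The underlying type of `X_𝔮(K_∞, M) = 𝔖_𝔮(K_∞, M)^∧`. -/
  X : Type u
  /-- `X` is an abelian group. -/
  [addCommGroup : AddCommGroup X]
  /-- `X` is a `Λ(K_∞) = ℤ_p⟦T⟧`-module. -/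
  [module : Module (IwasawaAlgebra p) X]
  /-- The identification with the character group `Hom(𝔖_𝔮(K_∞, M), ℚ/ℤ)`. -/
  toDual : X →+ (restrictedSelmerZp κ M 𝔮 →+ AddCircle (1 : ℚ))
  /-- `toDual` is a group isomorphism. -/
  bijective : Function.Bijective toDual
  /-- `T` acts as `γ − 1`: `(T·x)(s) = x(conj_γ s) − x(s)`. -/
  toDual_T_smul : ∀ (x : X) (s : restrictedSelmerZp κ M 𝔮),
    toDual ((PowerSeries.X : IwasawaAlgebra p) • x) s = toDual x (conjRestricted κ M 𝔮 γ s) - toDual x s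
  /-- Constants `c ∈ ℤ_p` act on `p^k`-torsion classes through `ℤ_p → ℤ/p^k`. -/
  toDual_C_smul : ∀ (c : ℤ_[p]) (x : X) (s : restrictedSelmerZp κ M 𝔮) (k : ℕ), (p ^ k) • s = 0 →
    toDual (PowerSeries.C c • x) s = (PadicInt.toZModPow k c).val • toDual x s

attribute [instance] RestrictedDualData.addCommGroup RestrictedDualData.module

variable {κ M 𝔮} in
/-- Any dual datum is, as a group, the character group of `𝔖_𝔮(K_∞, M)`: the `AddEquiv` packaged from
`toDual` / `bijective`. [cite: Agboola2007, §3 (arXiv p0008:L94–95)] -/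
def RestrictedDualData.toDualEquiv {γ : absoluteGaloisGroup K} (D : RestrictedDualData κ M 𝔮 γ) :
    D.X ≃+ (restrictedSelmerZp κ M 𝔮 →+ AddCircle (1 : ℚ)) :=
  AddEquiv.ofBijective D.toDual D.bijective

variable {M} in
/-- **`X_𝔮(K_∞, M) = Hom(𝔖_𝔮(K_∞, M), ℚ/ℤ)` with its `Λ(K_∞)`-structure IS a `RestrictedDualData`** (`toDual = id`),
for `M` `p`-primary with open stabilisers (so that `γ − 1` is locally nilpotent, `isLocNil_conjRestricted_sub_one`,
and the tree's `IwasawaDual.IsLocNil.module` applies): the EXISTENCE of Agboola's Iwasawa module as a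
`Λ(K_∞)`-module, for every `ℤ_p`-extension `κ` and every topological generator `γ`.
[cite: Agboola2007, §1 p. 2 (arXiv p0004:L3–13) and §3 (p0008:L94–95)] [cite: GreenbergLNM1716, §1 (after Conj. 1.3)] -/
def restrictedDualData (htor : ∀ m : M, ∃ k : ℕ, p ^ k • m = 0)
    (hstab : ∀ m : M, IsOpen (MulAction.stabilizer (absoluteGaloisGroup K) m : Set (absoluteGaloisGroup K)))
    {γ : absoluteGaloisGroup K} (hγ : κ.IsTopGenerator γ) : RestrictedDualData κ M 𝔮 γ :=
  { X := restrictedSelmerZp κ M 𝔮 →+ AddCircle (1 : ℚ)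
    module := (isLocNil_conjRestricted_sub_one κ 𝔮 htor hstab hγ).module
    toDual := AddMonoidHom.id _
    bijective := Function.bijective_id
    toDual_T_smul := fun x s ↦ by
      show (isLocNil_conjRestricted_sub_one κ 𝔮 htor hstab hγ).smulFun PowerSeries.X x s = x _ - x s
      rw [(isLocNil_conjRestricted_sub_one κ 𝔮 htor hstab hγ).smulFun_X_apply,
        IwasawaDual.End_sub_apply, AddMonoid.End.one_apply, map_sub]
    toDual_C_smul := fun c x s k hk ↦ by
      show (isLocNil_conjRestricted_sub_one κ 𝔮 htor hstab hγ).smulFun (PowerSeries.C c) x s = _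
      exact (isLocNil_conjRestricted_sub_one κ 𝔮 htor hstab hγ).smulFun_C_apply c x hk }

/-! ## §3 The characteristic ideal `Ch_Λ(X_𝔮(K_∞, M))` and the shape «`ord_p H(0) = n`» -/

namespace RestrictedDualData

variable {κ M 𝔮} {γ : absoluteGaloisGroup K}

/-- **`Ch_Λ(X_𝔮(K_∞, M)) ⊆ Λ(K_∞)`**, the characteristic ideal of the dual datum's `Λ`-module (the tree's
`Module.charIdeal`; meaningful for finitely generated torsion `X`, which is NOT asserted). A generator is Agboola's
"characteristic power series `H_K ∈ Λ(K_∞^*)` of `X_{𝔭*}(K_∞^*, W^*)`" (for `F = K`; over a finite `F/K` he uses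
`Λ(F_∞^*)_𝒪` — TODO(general form)). [cite: Agboola2007, §1 p. 2 (arXiv p0004:L9–13)] -/
def charIdeal (D : RestrictedDualData κ M 𝔮 γ) : Ideal (IwasawaAlgebra p) :=
  Literature.NumberTheory.EllipticCurves.Module.charIdeal (IwasawaAlgebra p) D.X

/-- **"`X_𝔮(K_∞, M)` is `Λ`-torsion and `ord_p H(0) = n`"** on a dual datum: `X` is a torsion `Λ`-module, its
characteristic ideal is principal with a generator `H` whose constant term `H(0) ∈ ℤ_p` is non-zero of `p`-adic
valuation `n` — the left-hand side of Agboola's Thm. 2 at `r = 1` ("`L_𝔭^*(1) ∼ p^{−2} · |Ш(K)(𝔭*)| · log_{E,𝔭*}(y_{𝔭*})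
· log_{E,𝔭}(y_𝔭)`", read through "`H_K` … an algebraic `p`-adic `L`-function corresponding to `L_𝔭^*(s)`"), in the
shape of the tree's `Castella2018.AcSelmer.XAc.HasCharValuationAt`. A predicate; nothing asserted.
[cite: Agboola2007, Thm. 2 (arXiv p0004:L93–101) and §1 p. 2 (p0004:L9–13)] -/
def HasCharValuationAt (D : RestrictedDualData κ M 𝔮 γ) (n : ℕ) : Prop :=
  Module.IsTorsion (IwasawaAlgebra p) D.X ∧
    ∃ H : IwasawaAlgebra p, D.charIdeal = Ideal.span {H} ∧
      PowerSeries.constantCoeff H ≠ 0 ∧ (PowerSeries.constantCoeff H).valuation = n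

/-- `ord_p H(0)` is well defined: two instances of `HasCharValuationAt` on one datum carry the same `n`
(generator independence, `Castella2018.AcSelmer.valuation_constantCoeff_eq_of_span_singleton_eq`).
[cite: Agboola2007, §1 p. 2 (arXiv p0004:L9–13)] [cite: Castella2018, Thm. 2.3 (arXiv:1704.06608 p. 5)] -/
theorem HasCharValuationAt.unique {D : RestrictedDualData κ M 𝔮 γ} {m n : ℕ}
    (hm : D.HasCharValuationAt m) (hn : D.HasCharValuationAt n) : m = n := by
  obtain ⟨_, f, hf, hf0, hfm⟩ := hm
  obtain ⟨_, g, hg, _, hgn⟩ := hn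
  rw [← hfm, ← hgn]
  exact ((Castella2018.AcSelmer.valuation_constantCoeff_eq_of_span_singleton_eq (hf.symm.trans hg) hf0).2).symm

/-- Introduction rule: a torsion datum with a principal characteristic ideal `(H)`, `H(0) ≠ 0`, `ord_p H(0) = n`
has the shape at `n` (how a main-conjecture-plus-control statement with its own `∃ H` feeds the predicate).
[cite: Agboola2007, §1 p. 2 (arXiv p0004:L9–13)] -/
theorem hasCharValuationAt_of_eq {D : RestrictedDualData κ M 𝔮 γ} {n : ℕ} {H : IwasawaAlgebra p}
    (htors : Module.IsTorsion (IwasawaAlgebra p) D.X) (hH : D.charIdeal = Ideal.span {H})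
    (hH0 : PowerSeries.constantCoeff H ≠ 0) (hn : (PowerSeries.constantCoeff H).valuation = n) :
    D.HasCharValuationAt n :=
  ⟨htors, H, hH, hH0, hn⟩

end RestrictedDualData

end Generic

end Literature.NumberTheory.EllipticCurves.Agboola2007

end
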